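import Summits.CriticalPhenomena.PercolationContinuityZ3.Theorems.PercNearOneGluingNoHeavyLowerTailSunflowerMultiPetalSlackExpansion
import HarnessLib
import HarnessLib.Audit

/-!
# `NoHeavyLowerTail` (crux stmt-CriticalPhenomena-4575), abstract sunflower cubic, `k` petals: the four POSITIVE-GAP PATTERNS of the configuration
# expansion as usable lemmas — each occurrence forces strict antipodal Gladkov on the full cube (`slackTop ≥ 2`)

Support file (seat `prim-l12-p2` gen 31; `--supports stmt-CriticalPhenomena-4575`; companion of `…SunflowerMultiPetalSlackExpansion` (p364652: `cgap`, `slackTop`,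
`two_le_slackTop_of_cgap_pos`, `two_le_slackTop_of_cover`)).  Everything here is PROVED; no `sorry`, no named facts, no conjecture.
Memo: run/shared/lean/prim/prim-l12/prim-l12-p2/FINDING-g31-TOPCUBE-STRICTNESS.md §1.1.

The submodularity gap of a configuration `(X, Y; e)` is positive exactly for the label patterns {white→black, ·}, {white→c, white→c'}, {white→c, c→black},
{c→black, c'→black} (`c ≠ c'` petals).  Here: the kernel values needed (`kkK_petal_petal`, `kkK_petal_last`, `kkK_zero_petal`, `kkK_last_last`, `kkK_zero_zero`),
the symmetry `cgap_comm`, the orientation-free configuration lemma `two_le_slackTop_of_cgap_pos'` (`X ≠ Y`, `e ∉ X ∪ Y`, gap ≥ 1 ⟹ `slackTop ≥ 2`), and the three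
pattern lemmas **`two_le_slackTop_of_two_black_covers`** {c→A, c'→A} (e.g. two maximal grey sets of different petals and a coordinate outside both),
**`two_le_slackTop_of_two_white_lower_covers`** {B→c, B→c'} (e.g. two minimal grey sets of different petals sharing a coordinate) and
**`two_le_slackTop_of_enter_and_leave`** {B→c, c→A}.  Their contrapositives define the RIGID regime used by Theorem T (`…SlackRigidity`).
-/

namespace Summit.CriticalPhenomena.PercolationContinuityZ3.Theorems.SunflowerPartition

open Finset

variable {α : Type*} [DecidableEq α]

namespace MSunflower

variable {k : ℕ} (F : MSunflower k α)

/-! ### Kernel values and the symmetry of the gap -/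

/-- A petal label (neither bottom nor top) together with `kkK`: two DISTINCT petals give `kkK = -1`, anything with top/bottom as computed. [this work] -/
theorem kkK_petal_petal {a b : Fin (k + 2)} (ha0 : a ≠ 0) (hat : a ≠ Fin.last (k + 1)) (hb0 : b ≠ 0) (hbt : b ≠ Fin.last (k + 1))
    (hab : a ≠ b) : kkK k a b = -1 := by
  unfold kkK; simp [ha0, hat, hb0, hbt, hab]

/-- `kkK` vanishes when the first label is a petal and the second is top. [this work] -/
theorem kkK_petal_last {a : Fin (k + 2)} (ha0 : a ≠ 0) (hat : a ≠ Fin.last (k + 1)) : kkK k a (Fin.last (k + 1)) = 0 := by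
  have h : (Fin.last (k + 1) : Fin (k + 2)) ≠ 0 := by
    intro h; have := congrArg Fin.val h; simp at this
  unfold kkK; simp [ha0, hat, h]

/-- `kkK` vanishes when the first label is bottom and the second a petal. [this work] -/
theorem kkK_zero_petal {b : Fin (k + 2)} (hb0 : b ≠ 0) (hbt : b ≠ Fin.last (k + 1)) : kkK k 0 b = 0 := by
  have h : (0 : Fin (k + 2)) ≠ Fin.last (k + 1) := by
    intro h; have := congrArg Fin.val h; simp at this
  unfold kkK; simp [hb0, hbt, h]

/-- `kkK` on (top, top) and (bottom, bottom) vanishes. [this work] -/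
theorem kkK_last_last : kkK k (Fin.last (k + 1)) (Fin.last (k + 1)) = 0 := by
  have h : (Fin.last (k + 1) : Fin (k + 2)) ≠ 0 := by
    intro h; have := congrArg Fin.val h; simp at this
  unfold kkK; simp [h]

/-- `kkK 0 0 = 0`. [this work] -/
theorem kkK_zero_zero : kkK k (0 : Fin (k + 2)) 0 = 0 := by
  have h : (0 : Fin (k + 2)) ≠ Fin.last (k + 1) := by
    intro h; have := congrArg Fin.val h; simp at this
  unfold kkK; simp [h]

/-- `cgap` is symmetric in the two sets. [this work] -/
theorem cgap_comm (X Y : Finset α) (e : α) : F.cgap X Y e = F.cgap Y X e := by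
  unfold cgap
  rw [kkK_comm k (F.lab X) (F.lab (insert e Y)), kkK_comm k (F.lab (insert e X)) (F.lab Y),
    kkK_comm k (F.lab X) (F.lab Y), kkK_comm k (F.lab (insert e X)) (F.lab (insert e Y))]
  ring

variable [Fintype α]

/-! ### The four positive-gap patterns as usable lemmas (memo §1.1): each occurrence forces `slackTop ≥ 2` -/

/-- Configuration lemma without the orientation hypothesis: `X ≠ Y`, `e ∉ X ∪ Y`, positive gap ⟹ `slackTop ≥ 2`. [this work] -/
theorem two_le_slackTop_of_cgap_pos' {X Y : Finset α} {e : α} (hXY : X ≠ Y) (heX : e ∉ X) (heY : e ∉ Y)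
    (hgap : 1 ≤ F.cgap X Y e) : 2 ≤ F.slackTop := by
  by_cases h : X ⊆ Y
  · have hne : (Y \ X).Nonempty := by
      rw [sdiff_nonempty]; intro h'; exact hXY (subset_antisymm h h')
    obtain ⟨v, hv⟩ := hne
    rw [mem_sdiff] at hv
    rw [F.cgap_comm] at hgap
    exact F.two_le_slackTop_of_cgap_pos hv.1 hv.2 heY heX hgap
  · rw [not_subset] at h
    obtain ⟨v, hvX, hvY⟩ := h
    exact F.two_le_slackTop_of_cgap_pos hvX hvY heX heY hgap

/-- **Pattern {c→black, c'→black}** (e.g. two maximal grey sets of different petals and a coordinate outside both): `slackTop ≥ 2`. [this work] -/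
theorem two_le_slackTop_of_two_black_covers {X Y : Finset α} {e : α} (heX : e ∉ X) (heY : e ∉ Y)
    (hX0 : F.lab X ≠ 0) (hXt : F.lab X ≠ Fin.last (k + 1)) (hY0 : F.lab Y ≠ 0) (hYt : F.lab Y ≠ Fin.last (k + 1))
    (hXY : F.lab X ≠ F.lab Y) (hXe : F.lab (insert e X) = Fin.last (k + 1)) (hYe : F.lab (insert e Y) = Fin.last (k + 1)) :
    2 ≤ F.slackTop := by
  have hne : X ≠ Y := fun h => hXY (h ▸ rfl)
  refine F.two_le_slackTop_of_cgap_pos' hne heX heY ?_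
  have h1 : kkK k (F.lab X) (Fin.last (k + 1)) = 0 := kkK_petal_last hX0 hXt
  have h2 : kkK k (Fin.last (k + 1)) (F.lab Y) = 0 := by rw [kkK_comm]; exact kkK_petal_last hY0 hYt
  have h3 : kkK k (F.lab X) (F.lab Y) = -1 := kkK_petal_petal hX0 hXt hY0 hYt hXY
  have h4 : kkK k (Fin.last (k + 1)) (Fin.last (k + 1)) = 0 := kkK_last_last
  unfold cgap
  rw [hXe, hYe, h1, h2, h3, h4]
  norm_num

/-- **Pattern {white→c, white→c'}** (e.g. two minimal grey sets of different petals sharing a coordinate): `slackTop ≥ 2`. [this work] -/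
theorem two_le_slackTop_of_two_white_lower_covers {X Y : Finset α} {e : α} (heX : e ∉ X) (heY : e ∉ Y)
    (hX : F.lab X = 0) (hY : F.lab Y = 0)
    (hXe0 : F.lab (insert e X) ≠ 0) (hXet : F.lab (insert e X) ≠ Fin.last (k + 1))
    (hYe0 : F.lab (insert e Y) ≠ 0) (hYet : F.lab (insert e Y) ≠ Fin.last (k + 1))
    (hne : F.lab (insert e X) ≠ F.lab (insert e Y)) : 2 ≤ F.slackTop := by
  have hXY : X ≠ Y := fun h => hne (h ▸ rfl)
  refine F.two_le_slackTop_of_cgap_pos' hXY heX heY ?_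
  have h1 : kkK k 0 (F.lab (insert e Y)) = 0 := kkK_zero_petal hYe0 hYet
  have h2 : kkK k (F.lab (insert e X)) 0 = 0 := by rw [kkK_comm]; exact kkK_zero_petal hXe0 hXet
  have h3 : kkK k (0 : Fin (k + 2)) 0 = 0 := kkK_zero_zero
  have h4 : kkK k (F.lab (insert e X)) (F.lab (insert e Y)) = -1 := kkK_petal_petal hXe0 hXet hYe0 hYet hne
  unfold cgap
  rw [hX, hY, h1, h2, h3, h4]
  norm_num

/-- **Pattern {white→c, c→black}** (a white set entering petal `c` at `e` and a set of the same petal `c` leaving to black at `e`): `slackTop ≥ 2`. [this work] -/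
theorem two_le_slackTop_of_enter_and_leave {X Y : Finset α} {e : α} (heX : e ∉ X) (heY : e ∉ Y)
    (hX : F.lab X = 0) (hXe0 : F.lab (insert e X) ≠ 0) (hXet : F.lab (insert e X) ≠ Fin.last (k + 1))
    (hY : F.lab Y = F.lab (insert e X)) (hYe : F.lab (insert e Y) = Fin.last (k + 1)) : 2 ≤ F.slackTop := by
  have hXY : X ≠ Y := by
    intro h; rw [← h, hX] at hY; exact hXe0 hY.symm
  refine F.two_le_slackTop_of_cgap_pos' hXY heX heY ?_
  have h1 : kkK k (0 : Fin (k + 2)) (Fin.last (k + 1)) = 1 := by rw [kkK_comm]; exact kkK_last_zero k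
  have h2 : kkK k (F.lab (insert e X)) (F.lab (insert e X)) = 0 := by unfold kkK; simp [hXe0, hXet]
  have h3 : kkK k 0 (F.lab (insert e X)) = 0 := kkK_zero_petal hXe0 hXet
  have h4 : kkK k (F.lab (insert e X)) (Fin.last (k + 1)) = 0 := kkK_petal_last hXe0 hXet
  unfold cgap
  rw [hX, hYe, hY, h1, h2, h3, h4]
  norm_num

end MSunflower

end Summit.CriticalPhenomena.PercolationContinuityZ3.Theorems.SunflowerPartition
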